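import Summits.MatrixMultiplication.OmegaCensus.DominoZ7Z7Consist9x29Reps
import Summits.MatrixMultiplication.OmegaCensus.DominoZpZpConsistTri
import HarnessLib

/-!
# Cell `(1,9,29)@784` over `ℤ_7²`, moment-consistency route: triangular row verdicts K (11 of 19)

ω-census `pub-omega`, family (b3), seat pub-omega-group gen 27.  Framing: lottery ticket; floor = certified bounds/negative
ranges.  VALUE: kernel instance data of the moment-consistency route (`DominoZpZpConsist*.lean`, G5 of
`HOME/pub-omega-group-g26/FAMILY-B-ADDENDUM-g26.md`) for the census cell `(1,9,29)@784` (`A ↠ ℤ_7 × ℤ_7`, `|A| = 784 = 7·112`);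
NOT progress on ω.  Generated by `HOME/pub-omega-group-g27/code/gen_cell.py` from the exact line census of gen 26
(`table_p7_d9_e29.json`, engines E1 = E2), every certificate re-verified by independent integer arithmetic before emission.

Triangular row verdicts `triRow 7 5 Lst L0 i = true` (`Lst = expandLst 7 (lstOfTable tabZ7d9)`, `L0 = l0Z7d9`, row `i` against the
columns `j ≥ i`) for the rows `60 ≤ i < 69` — 3 kernel `decide`s of ≤ 400 pivot pairs each (orders 2..5).
-/

namespace Summit.MatrixMultiplication.OmegaCensus

open ZpZpDomino

namespace ZpZpDomino

set_option maxRecDepth 100000 in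
set_option maxHeartbeats 4000000 in
/-- Rows `60 ≤ i < 63` (396 pivot pairs): every pair is DEAD (kernel `decide`). [folklore] -/
theorem triZ7d9_60 : (List.range' 60 3).all (triRow 7 5 (expandLst 7 (lstOfTable tabZ7d9)) l0Z7d9) = true := by
  decide +kernel

set_option maxRecDepth 100000 in
set_option maxHeartbeats 4000000 in
/-- Rows `63 ≤ i < 66` (387 pivot pairs): every pair is DEAD (kernel `decide`). [folklore] -/
theorem triZ7d9_63 : (List.range' 63 3).all (triRow 7 5 (expandLst 7 (lstOfTable tabZ7d9)) l0Z7d9) = true := by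
  decide +kernel

set_option maxRecDepth 100000 in
set_option maxHeartbeats 4000000 in
/-- Rows `66 ≤ i < 69` (378 pivot pairs): every pair is DEAD (kernel `decide`). [folklore] -/
theorem triZ7d9_66 : (List.range' 66 3).all (triRow 7 5 (expandLst 7 (lstOfTable tabZ7d9)) l0Z7d9) = true := by
  decide +kernel

/-- Rows `60 ≤ i < 69` of this file together. [folklore] -/
theorem triFZ7d9_K : (List.range' 60 9).all (triRow 7 5 (expandLst 7 (lstOfTable tabZ7d9)) l0Z7d9) = true := by
  have e : List.range' 60 9 = List.range' 60 3 ++ List.range' 63 3 ++ List.range' 66 3 := by decide +kernel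
  rw [e]; simp only [List.all_append, triZ7d9_60, triZ7d9_63, triZ7d9_66, Bool.and_self]


end ZpZpDomino

end Summit.MatrixMultiplication.OmegaCensus
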